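import Summits.BirchSwinnertonDyer.BirchSwinnertonDyer.Theorems.GenusKolyvaginAtTwoOffCutResidualAtTwoRSocleSelectionRealVisibleRealPlace
import Summits.BirchSwinnertonDyer.BirchSwinnertonDyer.Theorems.GenusKolyvaginAtTwoOffCutResidualAtTwoRSocleSelectionRealVisibleSplit
import HarnessLib

/-!
# Route `GenusKolyvaginAtTwo`, residual `OffCutResidualAtTwoR` (stmt-BirchSwinnertonDyer-31767), LINE 27 «socle_selection» STUB S2, conjunct (HL) —
# A REAL-TRIVIAL PHANTOM CLASS IS ZERO at a real place whose complex conjugation fixes `E[2]` and acts on `E[2^k]` neither as `1` nor as `−1`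
# (assembly of `…RealVisibleRealPlace` and `…RealVisibleSplit`; the complex conjugation of a real place is an involution of `Γ_K`)

Seat `bsd-line-gk2-p4` g30 (cell `bsd-f1-sign2`), WIDTH-5 attach on route `GenusKolyvaginAtTwo` rev 59.  `--supports stmt-BirchSwinnertonDyer-31767 --as
helper`.  THEOREMS ONLY (no definition, no named fact, no `sorry`); standard axioms.  **BSD is NOT proved by this file; `OffCutResidualAtTwoR` is NOT
proved; LINE 27's stub S2 is NOT closed by this file alone.**

* §1 `resGal_mul_self_of_isReal` — at a REAL place `w`, for `σ ≠ 1` in `Γ_{K_w}`: `c_w := resGal K_w σ` satisfies `c_w · c_w = 1`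
  (tree `absGaloisRestrict_mul_self_of_isReal`, `resGal = absGaloisRestrict`).
* §2 ★ `eq_zero_of_phantom_of_mem_torsionLocalKer_of_involution` — `ρ̄_{E,2^k}` surjective; `c = resGal F σ` an involution fixing `E[2]` with `c ≠ 1`,
  `c ≠ −1` on `E[2^k]`: every phantom `x ∈ H¹(K, E[2^k])` in `torsionLocalKer F 2^k` is `0`; ★ `…_infinitePlace_of_isReal` — the same at a real place `w`
  with the involution clause DISCHARGED (§1): hypotheses left = «`c_w` fixes `E[2]`», «`c_w ≠ 1` on `E[2^k]`», «`c_w ≠ −1` on `E[2^k]`».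
READING (Δ > 0, `K = ℚ`, `k ≥ 2`): all three clauses hold for the complex conjugation — `E[2] ⊂ E(ℝ)` (three real roots), a non-real `4`-torsion point
exists (an egg `2`-torsion point is not halvable over `ℝ`), a real point of order `4` exists (halve the off-egg `2`-torsion point over `ℝ`) — and their
transcription along `torsionPointsMap W ℚ_∞` (equivariant bijection `E[n](ℚ̄) ≃ E(ℚ̄_∞)[n]`) is the remaining archimedean sequel.
BSD is NOT proved by any of this.

References: [LawsonWuthrich2016] Lemma 3, §7.1; [GrossLMS1991] §9; [SerreGaloisCohomology1997] II.§6.1; [Kramer1981] §2 Prop. 6.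
-/

set_option autoImplicit false
set_option linter.dupNamespace false -- `Summit.<P>.<Sub>` repeats `BirchSwinnertonDyer` (D-0017)

noncomputable section

open scoped Classical

namespace Summit.BirchSwinnertonDyer.BirchSwinnertonDyer.Theorems.GenusExact.PlusDescent.SocleSelection.RealVisible

open WeierstrassCurve Field NumberField Literature.NumberTheory.EllipticCurves Literature.NumberTheory.GaloisRepresentations

universe u

/-! ## §1 The complex conjugation of a real place is an involution of `Γ_K` -/

section Real

variable {K : Type u} [Field K] [NumberField K]

omit [NumberField K] in
/-- **`c_w · c_w = 1`** for `c_w = resGal K_w σ`, `σ ≠ 1` in `Γ_{K_w}`, `w` a real place: `resGal` is the tree's `absGaloisRestrict` (`rfl`) and the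
restriction of the non-trivial element at a real place is an involution (`absGaloisRestrict_mul_self_of_isReal`). [cite: SerreGaloisCohomology1997, II.§6.1] -/
theorem resGal_mul_self_of_isReal {w : InfinitePlace K} (hw : w.IsReal) {σ : absoluteGaloisGroup w.Completion} (hσ : σ ≠ 1) :
    resGal (K := K) w.Completion σ * resGal (K := K) w.Completion σ = 1 := by
  rw [resGal_eq_absGaloisRestrict]
  exact absGaloisRestrict_mul_self_of_isReal hw hσ

end Real

/-! ## §2 ★ Real-trivial phantom classes vanish (involution form) -/

section Main

variable {K : Type u} [Field K] [NumberField K] (W : WeierstrassCurve K) [W.IsElliptic]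

/-- ★ **A real-trivial phantom class is zero, involution form.**  `K` a number field, `E/K` elliptic with `ρ̄_{E,2^k}` surjective (`k = j + 1`), `F` a
`K`-field of characteristic `0` (a completion) and `σ ∈ Γ_F` such that `c = resGal F σ ∈ Γ_K` is an involution fixing `E[2]` and acting on `E[2^k]`
neither as `1` nor as `−1` (at a REAL place with `Δ > 0`, `k ≥ 2`: the complex conjugation).  Then every `x ∈ H¹(K, E[2^k])` with `[x, ρ] = 0` for all
`ρ ∈ Γ_{K(E[2^k])}` and `x ∈ torsionLocalKer F 2^k` is `0`.  (`exists_split_of_involution` + `eq_zero_of_phantom_of_mem_torsionLocalKer_of_split`.)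
[cite: LawsonWuthrich2016, Lemma 3, §7.1] [cite: GrossLMS1991, §9] [cite: SerreGaloisCohomology1997, II.§6.1] -/
theorem eq_zero_of_phantom_of_mem_torsionLocalKer_of_involution (j : ℕ)
    (hsurj : W.HasSurjectiveModNGaloisRep ((2 ^ (j + 1) : ℕ) : ℤ))
    (F : Type u) [Field F] [Algebra K F] [CharZero F] (σ : absoluteGaloisGroup F)
    (hc2 : resGal (K := K) F σ * resGal (K := K) F σ = 1)
    (hfix : ∀ T : geomPoints W, (2 : ℤ) • T = 0 → resGal (K := K) F σ • T = T)
    (hne : ∃ R : geomTorsion W ((2 ^ (j + 1) : ℕ) : ℤ), resGal (K := K) F σ • R ≠ R)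
    (hne' : ∃ R : geomTorsion W ((2 ^ (j + 1) : ℕ) : ℤ), resGal (K := K) F σ • R ≠ -R)
    {x : galH1Torsion W ((2 ^ (j + 1) : ℕ) : ℤ)}
    (hph : ∀ ρ ∈ torsionFixing W ((2 ^ (j + 1) : ℕ) : ℤ), h1Eval W _ x ρ = 0)
    (hloc : x ∈ W.torsionLocalKer F ((2 ^ (j + 1) : ℕ) : ℤ)) : x = 0 := by
  have h2 : (2 : K) ≠ 0 := two_ne_zero
  obtain ⟨P, Q, hP, hQ, hPQ⟩ := exists_split_of_involution W j h2 hc2 hfix hne hne'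
  exact eq_zero_of_phantom_of_mem_torsionLocalKer_of_split W j hsurj F σ hP hQ hPQ hph hloc

/-- ★ **At a REAL place, with the involution clause discharged.**  `w` a real place of `K`, `σ ≠ 1` in `Γ_{K_w}`, `c_w := resGal K_w σ` (a complex
conjugation at `w`).  If `c_w` fixes `E[2]` pointwise and acts on `E[2^k]` neither as `1` nor as `−1`, then every phantom `x ∈ H¹(K, E[2^k])` lying in
`torsionLocalKer K_w 2^k` is `0`.  For `K = ℚ`, `Δ > 0`, `k ≥ 2` the three clauses are the archimedean facts «`E[2] ⊂ E(ℝ)`», «`E(ℝ)[4] ≠ E[4]`»,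
«`E(ℝ)` has a point of order `4`».  BSD is NOT proved by this. [cite: LawsonWuthrich2016, §7.1] [cite: Kramer1981, §2 Prop. 6] [cite: SerreGaloisCohomology1997, II.§6.1] -/
theorem eq_zero_of_phantom_of_mem_torsionLocalKer_infinitePlace_of_isReal (j : ℕ)
    (hsurj : W.HasSurjectiveModNGaloisRep ((2 ^ (j + 1) : ℕ) : ℤ))
    {w : InfinitePlace K} (hw : w.IsReal) {σ : absoluteGaloisGroup w.Completion} (hσ : σ ≠ 1)
    (hfix : ∀ T : geomPoints W, (2 : ℤ) • T = 0 → resGal (K := K) w.Completion σ • T = T)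
    (hne : ∃ R : geomTorsion W ((2 ^ (j + 1) : ℕ) : ℤ), resGal (K := K) w.Completion σ • R ≠ R)
    (hne' : ∃ R : geomTorsion W ((2 ^ (j + 1) : ℕ) : ℤ), resGal (K := K) w.Completion σ • R ≠ -R)
    {x : galH1Torsion W ((2 ^ (j + 1) : ℕ) : ℤ)}
    (hph : ∀ ρ ∈ torsionFixing W ((2 ^ (j + 1) : ℕ) : ℤ), h1Eval W _ x ρ = 0)
    (hloc : x ∈ W.torsionLocalKer w.Completion ((2 ^ (j + 1) : ℕ) : ℤ)) : x = 0 := by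
  haveI : CharZero w.Completion := charZero_of_injective_algebraMap (algebraMap K w.Completion).injective
  exact eq_zero_of_phantom_of_mem_torsionLocalKer_of_involution W j hsurj w.Completion σ (resGal_mul_self_of_isReal hw hσ) hfix hne hne'
    hph hloc

end Main

end Summit.BirchSwinnertonDyer.BirchSwinnertonDyer.Theorems.GenusExact.PlusDescent.SocleSelection.RealVisible

end
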